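import Summits.Langlands.Langlands.Statement
import Summits.Langlands.Langlands.Theorems.SmithKummerSeedCyclicPrimeDescentPrimeTwistMatching
import Summits.Langlands.Langlands.Theorems.BaseFieldAscentAscentConjugationSolvableAscentHelpers
import Literature.NumberTheory.Automorphic.BaseChangeArchimedeanDescent
import Literature.NumberTheory.Automorphic.GLnAdelicStructureProofs
import Literature.NumberTheory.GaloisRepresentations.ToLocalRestrictField
import Literature.NumberTheory.GaloisRepresentations.ArtinRestriction
import Literature.NumberTheory.PAdicHodge.DeRhamBaseChange
import HarnessLib

/-!
# Weak direction (B) DESCENDS along a Galois layer of prime degree — the IRREDUCIBLE-restriction case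
# (crux `AscentConjugationSolvable`, stmt-Langlands-1094; piece `CyclicPrimeDescent`, stmt-Langlands-18645;
# strategist stub `stub_descentWeakGalToAut`; lead c2 `--supports` helper)

Support file (closes nothing).  `stub_descentWeakGalToAut` (registered on stmt-Langlands-18645, its signature is the
conclusion below WITHOUT the restriction-irreducibility hypothesis) asks: for `L/K` Galois of prime degree, reciprocity
data `R` over `K` carrying direction (A) in every rank, and full reciprocity over `L`, every irreducible
`R`-geometric `ρ : Γ_K → GL_n(ℚ̄_ℓ)` is a.e. Satake–Frobenius compatible with some L-algebraic cuspidal `π` on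
`GL_n(𝔸_K)`.  Clifford theory along the cyclic layer splits it into two cases; this file settles the case
`ρ|_{Γ_L}` IRREDUCIBLE, conditionally on exactly four undischarged named facts of the tree (explicit hypotheses):
Arthur–Clozel's cyclic descent `cuspidal_descent_cyclic` (Ch. 3 Thm. 4.2 (d)), the archimedean clause of strong
lifting `ArthurClozel1989_strongLifting_archimedean` (Thm. 5.1), Clozel's existence of infinity types
`AutomorphicRepData.exists_hasInfinityType`, and Brinon–Conrad's `DeRhamBaseChange` (Prop. 6.3.8).

Argument (Barnet-Lamb–Gee–Geraghty–Taylor §5 / Harris–Taylor VII.1.9 for one cyclic layer), every step a tree theorem: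
`ρ|_{Γ_L}` is `R₁`-geometric (a.e. unramified: `isUnramifiedAt_restrictField`; de Rham at `w ∣ ℓ`:
`isDeRhamFramed_toLocal_restrictField` from `DeRhamBaseChange` — the pinned Fontaine datum ignores `R₁`); (B) over `L`
gives a cuspidal L-algebraic `P` corresponding to it; `P` descends to a cuspidal `π₁` on `GL_n(𝔸_K)` with `P` a weak base
change of `π₁` (`ReciprocityTRCM.exists_isWeakBaseChangeLiftAE_of_cuspidal_descent_cyclic`: Galois-stability of the
Satake data from the Galois side, then `cuspidal_descent_cyclic`); `π₁` is L-algebraic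
(`ArthurClozel1989_strongLifting_archimedean.isLAlgebraic_descent'`); and the prime-degree twist matching
(`primeTwistMatchingOfCyclicDescent`, p164316: (A) over `K`, Chebotarev over `L`, Clifford `ρ ≅ ρ₁ ⊗ χ`, Artin
reciprocity for `χ`, twist of `π₁`) produces `π`.  The level witness over `L` is the tree's theorem
`isCompact_glFiniteIntegralLevel_holds`.

NOT here: the case `ρ|_{Γ_L}` REDUCIBLE (`ρ ≅ Ind s` by the landed prime-index Clifford theorem
`exists_charpoly_eq_charpoly_induce_of_not_isIrreducible_restrictField_of_prime`, p165356; then automorphic induction of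
`π_s` — needs geometricity of the Clifford constituent `s` for the pinned datum and the facts
`automorphicInduction_cyclic_cuspidal`, `Henniart2012_infinityType_of_automorphicInduction`).

References: Arthur–Clozel, Ann. of Math. Stud. 120 (1989), Ch. 3 Thms. 4.2 (d), 5.1; Barnet-Lamb–Gee–Geraghty–Taylor,
Ann. of Math. 179 (2014), §5; Brinon–Conrad (2009), Prop. 6.3.8; Clozel (1990), §3.3; Clifford (1937), Thm. 1.
-/

noncomputable section

set_option linter.dupNamespace false -- project-wide option; `Summit.Langlands.Langlands` is the mandated namespace

namespace Summit.Langlands.Langlands.Theorems.SmithKummerSeedCyclicPrimeDescent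

open scoped MatrixGroups NumberField Classical Matrix Polynomial
open Filter IsDedekindDomain Field
open Literature.NumberTheory.Automorphic Literature.NumberTheory.GaloisRepresentations Literature.NumberTheory.PAdicHodge
open Summit.Langlands

/-- **Pinned geometricity restricts along `L/K`** (for ANY reciprocity data on both sides — the `p`-adic Hodge
datum is pinned and does not depend on them), granted `DeRhamBaseChange`: if `ρ` is `R`-geometric over `K` then
`ρ|_{Γ_L}` is `R₁`-geometric over `L`. [cite: BrinonConrad2009, Prop. 6.3.8] [cite: SerreAbelianLadic1968, Ch. I §2.1] -/
theorem isGeometricFramed_restrictField (hdR : DeRhamBaseChange) {K L : Type} [Field K] [NumberField K] [Field L]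
    [NumberField L] [Algebra K L] (R : ReciprocityData K) (R₁ : ReciprocityData L) {ℓ : ℕ} [Fact ℓ.Prime] {n : ℕ}
    (ρ : FramedGaloisRep K (PadicAlgCl ℓ) n) (h : IsGeometricFramed R ρ) :
    IsGeometricFramed R₁ (ρ.restrictField L) := by
  refine ⟨?_, fun w hw => ?_⟩
  · filter_upwards [eventually_under (E := L) h.1] with w hw
    exact ρ.isUnramifiedAt_restrictField (v := w.under (𝓞 K)) rfl (hw _ rfl)
  · exact isDeRhamFramed_toLocal_restrictField hdR ρ (fun v hv => h.2 v hv) w hw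

/-- **Registered stub `weakGalToAut_descent_of_irreducible_restrictField` (crux stmt-Langlands-1094, lead c2):
weak (B) over `K` from reciprocity over `L` and (A) over `K`, along a Galois layer `L/K` of PRIME degree, for the
`ρ` whose restriction to `Γ_L` is IRREDUCIBLE** — conditionally on the four named facts `cuspidal_descent_cyclic`,
`ArthurClozel1989_strongLifting_archimedean`, `exists_hasInfinityType` (all `π`), `DeRhamBaseChange` (hypotheses,
in this order).  The remaining binders are VERBATIM those of the strategist's `stub_descentWeakGalToAut` with the
extra hypothesis `(ρ.restrictField L).toGaloisRep.IsIrreducible`.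
[cite: ArthurClozelAMS120, Ch. 3 Thm. 4.2 (d) and Thm. 5.1] [cite: BarnetlambEtAl2014, §5] -/
theorem weakGalToAut_descent_of_irreducible_restrictField : Literature.NumberTheory.Automorphic.cuspidal_descent_cyclic → Literature.NumberTheory.Automorphic.ArthurClozel1989_strongLifting_archimedean → (∀ (n : ℕ) (K : Type) [Field K] [NumberField K] (hK : Literature.NumberTheory.Automorphic.isCompact_glFiniteIntegralLevel n K) (π : Literature.NumberTheory.Automorphic.AutomorphicRepData (Literature.NumberTheory.Automorphic.AutomorphyDatum.gl n K hK)), π.exists_hasInfinityType) → Literature.NumberTheory.PAdicHodge.DeRhamBaseChange → ∀ (K L : Type) [Field K] [NumberField K] [Field L] [NumberField L] [Algebra K L] [IsGalois K L] (R : ReciprocityData K), (Module.finrank K L).Prime → (∃ R₁ : ReciprocityData L, ∀ n : ℕ, 0 < n → ∀ hcpt : Literature.NumberTheory.Automorphic.isCompact_glFiniteIntegralLevel n L, GlobalLanglandsCorrespondenceGLn n L R₁ hcpt) → (∀ n : ℕ, 0 < n → ∀ hcpt : Literature.NumberTheory.Automorphic.isCompact_glFiniteIntegralLevel n K, AutomorphicToGalois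 n R hcpt) → ∀ (n : ℕ), 0 < n → ∀ (ℓ : ℕ) [Fact ℓ.Prime] (ι : PadicAlgCl ℓ ≃+* ℂ) (ρ : Literature.NumberTheory.GaloisRepresentations.FramedGaloisRep K (PadicAlgCl ℓ) n), ρ.toGaloisRep.IsIrreducible → IsGeometricFramed R ρ → (ρ.restrictField L).toGaloisRep.IsIrreducible → ∀ hcpt : Literature.NumberTheory.Automorphic.isCompact_glFiniteIntegralLevel n K, ∃ π : Literature.NumberTheory.Automorphic.CuspidalAutomorphicRepData n K hcpt, π.1.IsLAlgebraic ∧ ∀ᶠ v : IsDedekindDomain.HeightOneSpectrum (NumberField.RingOfIntegers K) in cofinite, SatakeFrobCompatibleAt ι π.1 ρ v := by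
  intro hdesc harch hinf hdR K L _ _ _ _ _ _ R hp hRL hAK n hn ℓ _ ι ρ _ hgeo hirrL hcpt
  haveI : FiniteDimensional K L := Module.Finite.of_restrictScalars_finite ℚ K L
  have hcyc : IsCyclic (L ≃ₐ[K] L) :=
    BaseFieldAscentAscentConjugationSolvable.isCyclic_algEquiv_of_finrank_prime K L hp
  obtain ⟨R₁, hL⟩ := hRL
  -- a level witness over `L` (the tree's theorem) and direction (B) over `L` in rank `n`
  have hcptL : isCompact_glFiniteIntegralLevel n L := isCompact_glFiniteIntegralLevel_holds n L
  obtain ⟨-, hBL⟩ := hL n hn hcptL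
  -- `ρ|_{Γ_L}` is irreducible and `R₁`-geometric, hence automorphic over `L`
  obtain ⟨P, hPL, hcorr⟩ := hBL ℓ ι (ρ.restrictField L) hirrL (isGeometricFramed_restrictField hdR R R₁ ρ hgeo)
  -- cyclic descent of `P` to `K` (Galois-stability of its Satake data comes from the Galois side)
  obtain ⟨π₁, hBC⟩ := ReciprocityTRCM.exists_isWeakBaseChangeLiftAE_of_cuspidal_descent_cyclic hdesc hcyc hp
    hcpt ι P ρ hcorr.1
  -- the descended representation is L-algebraic (archimedean clause of strong lifting)
  have hπ₁L : π₁.1.IsLAlgebraic := harch.isLAlgebraic_descent' hcyc hp hBC (hinf n K hcpt π₁.1) hPL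
  -- twist matching after cyclic descent (prime degree)
  exact primeTwistMatchingOfCyclicDescent n K L hp R hcpt hcptL (hAK n hn hcpt) ℓ ι ρ hirrL P π₁ hπ₁L hBC hcorr.1

end Summit.Langlands.Langlands.Theorems.SmithKummerSeedCyclicPrimeDescent

end
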